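import Summits.ABC.ABC.Theses.CuspFieldPencil
import Summits.ABC.ABC.Theorems.YuMatveevShapeRatCloses
import Summits.ABC.ABC.Theorems.PlacewiseSzpiroSingleTowerSzpiroBakerSinglePlace
import Summits.ABC.ABC.Theorems.LogCardinalitySubPowerStewartYuRoutes
import Summits.ABC.ABC.Theorems.TwoSixPencilPencilBoundMember
import Summits.ABC.ABC.Theorems.CuspFieldPencilGoldenFromNFPencil
import HarnessLib

/-!
# Stub-ideation sketch — `stub_splitCuspTriple` · ideator 3 · gen 3 (FAMILY 3: probe the extremes)

Crux `Summit.ABC.ABC.Theses.CuspFieldPencil.GoldenCuspShadow` (stmt-ABC-26026), route `CuspFieldPencil`.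
SIGNATURES ONLY (`sorry` bodies) + kernel-checked EXTREMAL UNIT TESTS (`example`s by `norm_num`/`decide`).
Technique: PERTURBATION FROM THE PROVED NEIGHBOURING CASE — every helper below is a ≤ 40-line delta of a
named, PROVED tree theorem (parent named in the docstring), on the unconditional rational place-bound line
(hidden ℤ-triple `T_u : u(u − 11w) + (−Q) = w²`, `Q = u² − 11uw − w²`; member-local Stewart–Yu routes through
the DIVISOR `u` of the member `u(u − 11w)`; input = the tree THEOREM `approximationBound_rat_holds`).
-/

set_option linter.dupNamespace false

noncomputable section

open Finset Real
open Literature.NumberTheory.DiophantineGeometry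
open Literature.NumberTheory.DiophantineGeometry.Dioph
open Literature.NumberTheory.DiophantineGeometry.Pasten
open Literature.Barriers.ABC

namespace Summit.ABC.ABC.Cruxes.GoldenCuspShadow.SplitCuspExtremes3

/-! ### 0 · Statements (the stub verbatim; the two route bounds) -/

/-- The registered stub `stub_splitCuspTriple`, verbatim. -/
def StubSplit : Prop :=
  ∀ ε : ℝ, 0 < ε → ∃ κ : ℝ, ∀ u w : ℤ, IsCoprime u w → u * w * (u ^ 2 - 11 * u * w - w ^ 2) ≠ 0 →
    Real.log (max (|(u : ℝ)|) (|(w : ℝ)|)) ≤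
      κ * (((UniqueFactorizationMonoid.radical (u * w * (u ^ 2 - 11 * u * w - w ^ 2))).natAbs : ℕ) : ℝ) ^ (ε : ℝ) *
        (((((UniqueFactorizationMonoid.radical u).natAbs : ℕ) : ℝ) *
            (((UniqueFactorizationMonoid.radical w).natAbs : ℕ) : ℝ)) ^ (2 / 3 : ℝ) *
          (((UniqueFactorizationMonoid.radical (u ^ 2 - 11 * u * w - w ^ 2)).natAbs : ℕ) : ℝ) ^ (1 / 3 : ℝ))

/-- Route-U bound: `log max(|u|,|w|) ≤ κ_ε · rad(uwQ)^ε · rad|u|`. -/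
def RouteBoundU : Prop :=
  ∀ ε : ℝ, 0 < ε → ∃ κ : ℝ, ∀ u w : ℤ, IsCoprime u w → u * w * (u ^ 2 - 11 * u * w - w ^ 2) ≠ 0 →
    Real.log (max (|(u : ℝ)|) (|(w : ℝ)|)) ≤
      κ * (((UniqueFactorizationMonoid.radical (u * w * (u ^ 2 - 11 * u * w - w ^ 2))).natAbs : ℕ) : ℝ) ^ ε *
        (((UniqueFactorizationMonoid.radical u).natAbs : ℕ) : ℝ)

/-- Route-W bound: the same with `rad|w|` (= `RouteBoundU` at `(u, w) ↦ (w, −u)`). -/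
def RouteBoundW : Prop :=
  ∀ ε : ℝ, 0 < ε → ∃ κ : ℝ, ∀ u w : ℤ, IsCoprime u w → u * w * (u ^ 2 - 11 * u * w - w ^ 2) ≠ 0 →
    Real.log (max (|(u : ℝ)|) (|(w : ℝ)|)) ≤
      κ * (((UniqueFactorizationMonoid.radical (u * w * (u ^ 2 - 11 * u * w - w ^ 2))).natAbs : ℕ) : ℝ) ^ ε *
        (((UniqueFactorizationMonoid.radical w).natAbs : ℕ) : ℝ)

/-! ### 1 · The hidden triple and its symmetry (XS, `ring`) -/

/-- `T_u`: `u(u − 11w) + (−Q) = w²`. [folklore] -/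
theorem pencil_identity (u w : ℤ) :
    u * (u - 11 * w) + -(u ^ 2 - 11 * u * w - w ^ 2) = w ^ 2 := by ring

/-- `(u, w) ↦ (w, −u)` fixes `uwQ` and negates `Q` (so `T_w` is `T_u` after the swap). [folklore] -/
theorem quadForm_swap (u w : ℤ) :
    w ^ 2 - 11 * w * (-u) - (-u) ^ 2 = -(u ^ 2 - 11 * u * w - w ^ 2) := by ring

theorem prod_swap (u w : ℤ) :
    w * (-u) * (w ^ 2 - 11 * w * (-u) - (-u) ^ 2) = u * w * (u ^ 2 - 11 * u * w - w ^ 2) := by ring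

/-! ### 2 · EXTREMAL UNIT TESTS (kernel-checked): the three sign shapes, the degenerate members,
the height constant -/

-- shape «|Q| on top»: (u,w) = (1,1): uu' = −10, Q = −11, w² = 1:  10 + 1 = 11
example : (1 : ℤ) * (1 - 11 * 1) = -10 ∧ (1 : ℤ) ^ 2 - 11 * 1 * 1 - 1 ^ 2 = -11 := by norm_num
-- shape «uu' on top»: (u,w) = (1,−1): uu' = 12, Q = 11, w² = 1:  1 + 11 = 12
example : (1 : ℤ) * (1 - 11 * (-1)) = 12 ∧ (1 : ℤ) ^ 2 - 11 * 1 * (-1) - (-1) ^ 2 = 11 := by norm_num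
-- shape «w² on top»: (u,w) = (−1,12): uu' = 133, Q = −11, w² = 144:  133 + 11 = 144
example : (-1 : ℤ) * (-1 - 11 * 12) = 133 ∧ (-1 : ℤ) ^ 2 - 11 * (-1) * 12 - 12 ^ 2 = -11 := by norm_num
-- degenerate member u' = 0 exactly at ±(11,1) (there Q = −1, w²·|Q| = 1: the only «1+1=2»-type danger,
-- and it is the excluded case `u = 11w`); the swap-degenerate w + 11u = 0 at ±(1,−11)
example : (11 : ℤ) - 11 * 1 = 0 ∧ (11 : ℤ) ^ 2 - 11 * 11 * 1 - 1 ^ 2 = -1 := by norm_num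
example : (-11 : ℤ) + 11 * 1 = 0 ∧ (1 : ℤ) ^ 2 - 11 * 1 * (-11) - (-11) ^ 2 = 1 := by norm_num
-- near the irrational cusp t = φ⁵ ≈ 11.09: (255,23): Q = −19, u' = 2, M = w² = 529, H² = 65025, H²/M ≈ 122.9 < 144
example : (255 : ℤ) ^ 2 - 11 * 255 * 23 - 23 ^ 2 = -19 ∧ (255 : ℤ) - 11 * 23 = 2 ∧ 65025 < 144 * 529 := by norm_num
-- `R^ε` is essential (k1-g2 §3.4): family (1, 2^a): rad u · rad w = 2, L = a log 2 unbounded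
example : IsCoprime (1 : ℤ) (2 ^ 7) := isCoprime_one_left

/-! ### 3 · Helper lemmas — each a perturbation of a NAMED proved tree theorem -/

/-- **E1 · cofactor route through `a`** (parent: `SubPowerSY.log_lt_route_a_erase`, 50 ll.; there ONE prime of
`a` is left unestimated, here the COFACTOR `a/d` is): for `d ∣ a`,
`log c < Θ_{bc} · Y · (1 + 3 ∑_{p ∣ d} p) + log(a/d)` (`Θ_{bc} = theta K b c 0`, `Y = log max{e, 2 log c}`).
Proof = parent's: `arch_bound` + `padic_bound_a` at the primes of `d` (`d.factorization p ≤ a.factorization p`,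
`Nat.factorization_le_iff_dvd`), `log a = log d + log(a/d)`. [S, ~40 ll.] -/
theorem log_lt_route_a_cofactor {K : ℝ} (hK : 1 ≤ K) (hP : PastenApproximationBound K)
    {a b c : ℕ} (h : IsABCTriple a b c) {d : ℕ} (hd : d ∣ a) :
    Real.log c < theta K b c 0 * Real.log (max (Real.exp 1) (2 * Real.log c)) *
      (1 + 3 * ∑ p ∈ d.primeFactors, (p : ℝ)) + Real.log ((a / d : ℕ) : ℝ) := by
  sorry

/-- **E2 · cofactor route through `c`** (parent: `Literature.Barriers.ABC.log_lt_route_c`, 30 ll.; needs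
`ab > 1`, i.e. not the triple `1 + 1 = 2`): for `d ∣ c`, `log c < Θ_{ab} · Y · (1 + 3 ∑_{p ∣ d} p) + log(c/d)`
(`padic_bound_c` at the primes of `d`; no archimedean step; the `1 +` is slack). [S, ~35 ll.] -/
theorem log_lt_route_c_cofactor {K : ℝ} (hK : 1 ≤ K) (hP : PastenApproximationBound K)
    {a b c : ℕ} (h : IsABCTriple a b c) (h1 : 1 < a * b) {d : ℕ} (hd : d ∣ c) :
    Real.log c < theta K a b 0 * Real.log (max (Real.exp 1) (2 * Real.log c)) *
      (1 + 3 * ∑ p ∈ d.primeFactors, (p : ℝ)) + Real.log ((c / d : ℕ) : ℝ) := by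
  sorry

/-- **E3 · `Θ` at threshold 0 is symmetric** (parent: `theta_zero_eq`, `mul_comm`). [XS] -/
theorem theta_zero_comm (K : ℝ) {u v : ℕ} (hu : u ≠ 0) (hv : v ≠ 0) (huv : u.Coprime v) :
    theta K u v 0 = theta K v u 0 := by
  sorry

/-- **E4 · integer member bound** (parents: `PencilBoundLine.exists_abcTriple_of_int_sum` for the 3-way sign
split + E1 / E1∘`IsABCTriple.swap` / E2 + E3): for `x + y = z` in nonzero integers, `gcd(x,y) = 1`,
`|y|·|z| > 1`, and `d ∣ |x|`: with `M = max(|x|,|y|,|z|)`,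
`log M < Θ₀(|y|,|z|) · log max{e, 2 log M} · (1 + 3 ∑_{p ∣ d} p) + log(|x|/d)`.
(The member `x` lands as `a`, `b` or `c` of the abc triple; all three shapes occur: §2.) [M, ~90 ll.] -/
theorem int_member_bound {K : ℝ} (hK : 1 ≤ K) (hP : PastenApproximationBound K)
    {x y z : ℤ} (hsum : x + y = z) (hx : x ≠ 0) (hy : y ≠ 0) (hz : z ≠ 0) (hcop : IsCoprime x y)
    (hyz : 1 < y.natAbs * z.natAbs) {d : ℕ} (hd : d ∣ x.natAbs) :
    Real.log ((max x.natAbs (max y.natAbs z.natAbs) : ℕ) : ℝ) <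
      theta K y.natAbs z.natAbs 0 *
          Real.log (max (Real.exp 1) (2 * Real.log ((max x.natAbs (max y.natAbs z.natAbs) : ℕ) : ℝ))) *
          (1 + 3 * ∑ p ∈ d.primeFactors, (p : ℝ)) +
        Real.log ((x.natAbs / d : ℕ) : ℝ) := by
  sorry

/-- **E5a · heights at the extremes** (§2: sup H²/M = φ¹⁰ ≈ 122.99, attained towards the cusp `t = φ⁵`; two
cases `|u| > 12|w|` ⇒ `|u − 11w| > |u|/12` ⇒ `|uu'| > H²/12`, else `H² ≤ 144 w²`); NO side condition is needed
(at `u = 11w` the ratio is 121, at `w = 0` it is 1). [S, `nlinarith` after the case split] -/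
theorem sq_height_le (u w : ℤ) :
    (max u.natAbs w.natAbs) ^ 2 ≤
      144 * max (u * (u - 11 * w)).natAbs (max (-(u ^ 2 - 11 * u * w - w ^ 2)).natAbs (w ^ 2).natAbs) := by
  sorry

/-- **E5b** the top is `≤ 13 H²` and the cofactor `|u − 11w| ≤ 12 H`. [XS] -/
theorem top_le (u w : ℤ) :
    max (u * (u - 11 * w)).natAbs (max (-(u ^ 2 - 11 * u * w - w ^ 2)).natAbs (w ^ 2).natAbs) ≤
      13 * (max u.natAbs w.natAbs) ^ 2 ∧ (u - 11 * w).natAbs ≤ 12 * max u.natAbs w.natAbs := by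
  sorry

/-- **E6 · non-degeneracy** («1 + 1 = 2» never occurs): `w²·|Q| = 1` forces `w = ±1`, `Q = −1`, `u ∈ {0, 11w}`
(`Q = +1` would need `u(u ∓ 11) = 2`, impossible). [S: `Int.natAbs` cases + `omega`/`decide`] -/
theorem one_lt_other_members {u w : ℤ} (hu : u ≠ 0) (hw : w ≠ 0) (hu' : u ≠ 11 * w)
    (hQ : u ^ 2 - 11 * u * w - w ^ 2 ≠ 0) :
    1 < (-(u ^ 2 - 11 * u * w - w ^ 2)).natAbs * (w ^ 2).natAbs := by
  sorry

/-- **E6b · the hidden triple is primitive**: `gcd(u(u − 11w), Q) = 1` (`Q ≡ −w² (mod u)` and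
`(mod u − 11w)`, `gcd(u − 11w, w) = gcd(u, w) = 1`; parents `GoldenFromNFPencil.isCoprime_quadForm_left`,
`IsCoprime.of_add_mul_right_left`-type lemmas). [XS] -/
theorem isCoprime_member {u w : ℤ} (h : IsCoprime u w) :
    IsCoprime (u * (u - 11 * w)) (-(u ^ 2 - 11 * u * w - w ^ 2)) := by
  sorry

/-- **E7 · ROUTE U** (E4 on `T_u` with `x = u(u−11w)`, `y = −Q`, `z = w²`, `d = |u|`; E5a/b turn `log M` into
`2L − log 144` and `log(|x|/d)` into `L + log 12`): for coprime `u, w`, `uwQ ≠ 0`, `u ≠ 11w`,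
`L ≤ log 1728 + Θ₀(|Q|, w²) · log max{e, 2 log(13 H²)} · (1 + 3 ∑_{p ∣ u} p)`. [S given E4–E6, ~60 ll.] -/
theorem route_u {K : ℝ} (hK : 1 ≤ K) (hP : PastenApproximationBound K) {u w : ℤ}
    (h : IsCoprime u w) (h0 : u * w * (u ^ 2 - 11 * u * w - w ^ 2) ≠ 0) (hu' : u ≠ 11 * w) :
    Real.log (max (|(u : ℝ)|) (|(w : ℝ)|)) ≤ Real.log 1728 +
      theta K (-(u ^ 2 - 11 * u * w - w ^ 2)).natAbs (w ^ 2).natAbs 0 *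
        Real.log (max (Real.exp 1) (2 * Real.log (13 * (max (|(u : ℝ)|) (|(w : ℝ)|)) ^ 2))) *
        (1 + 3 * ∑ p ∈ u.natAbs.primeFactors, (p : ℝ)) := by
  sorry

/-- **E8a · accounting, `Θ₀` is sub-polynomial in the radical** — IN THE TREE:
`SingleTowerSzpiroLine.theta_zero_le_mul_rpow` (with `exists_prod_mul_log_div_rpow_le` supplying `C`), applied to
the three naturals `(|Q|, w², |u|)` whose `rad` is `rad(uwQ)` (E8c). [XS wiring, ~25 ll.] -/
theorem theta_pencil_le {K C η : ℝ} (hK : 1 ≤ K) (hη : 0 ≤ η)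
    (hC : ∀ S : Finset ℕ, (∀ p ∈ S, p.Prime) → ∏ p ∈ S, K * Real.log p / (p : ℝ) ^ η ≤ C)
    {u w : ℤ} (h : IsCoprime u w) (h0 : u * w * (u ^ 2 - 11 * u * w - w ^ 2) ≠ 0) :
    theta K (-(u ^ 2 - 11 * u * w - w ^ 2)).natAbs (w ^ 2).natAbs 0 ≤
      K * C * (((UniqueFactorizationMonoid.radical (u * w * (u ^ 2 - 11 * u * w - w ^ 2))).natAbs : ℕ) : ℝ) ^ η := by
  sorry

/-- **E8b · the divisor sum costs `rad|u|`**: `1 + 3 ∑_{p ∣ n} p ≤ 4 · rad n` (parent: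
`Literature.Barriers.ABC.sum_le_prod_of_two_le` + `Nat.radical_eq_prod_primeFactors`). [XS] -/
theorem one_add_three_sum_le_four_rad {n : ℕ} (hn : n ≠ 0) :
    (1 : ℝ) + 3 * ∑ p ∈ n.primeFactors, (p : ℝ) ≤ 4 * ((UniqueFactorizationMonoid.radical n : ℕ) : ℝ) := by
  sorry

/-- **E8c · the radical of the hidden triple's clean members** (`Nat.primeFactors_mul/_pow`,
`GoldenFromNFPencil.natAbs_radical_prod`). [S] -/
theorem rad_pencil_eq {u w : ℤ} (h : IsCoprime u w) (h0 : u * w * (u ^ 2 - 11 * u * w - w ^ 2) ≠ 0) :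
    rad (-(u ^ 2 - 11 * u * w - w ^ 2)).natAbs (w ^ 2).natAbs u.natAbs =
      (UniqueFactorizationMonoid.radical (u * w * (u ^ 2 - 11 * u * w - w ^ 2))).natAbs := by
  sorry

/-- **E8d · log-absorption** — IN THE TREE: `Literature.Barriers.ABC.le_of_le_mul_log_max`
(`y ≤ M log max{e,2y} ⇒ y ≤ 2M log(4M)`), used with `y = L + log 13` (so `2 log(13H²) ≤ 4y`,
`log max{e,4y} ≤ 2 log max{e,2y}`) and `log(4M) ≤ C_η R^η` (`SingleTowerSzpiroLine.mul_log_le_rpow`). This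
wrapper is the only genuinely new real-analysis step; apply it with `A = log 1728`,
`X = max 1 (Θ₀ · (1 + 3 ∑_{p ∣ u} p))`. [S, ~40 ll.] -/
theorem absorb_loglog {L A X : ℝ} (hL : 0 ≤ L) (hA : 1 ≤ A) (hX : 1 ≤ X)
    (h : L ≤ A + X * Real.log (max (Real.exp 1) (2 * Real.log (13 * Real.exp L ^ 2)))) :
    L ≤ 16 * A * X * Real.log (16 * A * X) := by
  sorry

/-- **E9 · ROUTE-U BOUND** (E7 + E8a–d; `K` from `approximationBound_rat_holds`; the excluded points `u = 11w`
are `±(11,1)` with `L = log 11 ≤ κ`). [S/M assembly, ~80 ll.] -/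
theorem routeBoundU : RouteBoundU := by
  sorry

/-- **E10 · ROUTE-W by symmetry** (`RouteBoundU` at `(w, −u)`: `quadForm_swap`, `prod_swap`,
`IsCoprime.symm.neg_right`, `radical_neg`/`Int.natAbs_neg`, `max_comm`). [S, ~30 ll.] -/
theorem routeBoundW_of_routeBoundU (hU : RouteBoundU) : RouteBoundW := by
  sorry

/-- **E11 · the stub** from the two routes: `L² ≤ κ² R^{2ε'} rad u rad w` ⇒
`L ≤ κ R^{ε'} (rad u rad w)^{1/2} ≤ κ R^{ε'} (rad u rad w)^{2/3} rad(Q)^{1/3}` (bases `≥ 1`;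
`Real.rpow_le_rpow_of_exponent_le`, `Real.one_le_rpow`, `Real.sqrt_le_sqrt`). [S, ~50 ll.] -/
theorem stubSplit_of_routes (hU : RouteBoundU) (hW : RouteBoundW) : StubSplit := by
  sorry

/-- **E12 · and the CRUX itself** (`min ≤ (rad u rad w)^{1/2} ≤ rad(uwQ)^{1/2}`, `natAbs_radical_prod`):
the registered stub and `stub_conjugateCuspTriple` both become corollaries. [S, ~40 ll.] -/
theorem goldenCuspShadow_of_routes (hU : RouteBoundU) (hW : RouteBoundW) :
    Summit.ABC.ABC.Theses.CuspFieldPencil.GoldenCuspShadow := by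
  sorry

/-! ### 4 · Wiring check: the input is a THEOREM of the tree (no hypothesis survives) -/

example : ∃ K : ℝ, 1 ≤ K ∧ PastenApproximationBound K :=
  Summit.ABC.ABC.Theorems.approximationBound_rat_holds

/-- The parents exist with the expected shapes (elaboration-only checks). -/
example {K : ℝ} (hK : 1 ≤ K) (hP : PastenApproximationBound K) {a b c : ℕ} (h : IsABCTriple a b c)
    {P : ℕ} (hPa : P ∈ a.primeFactors) :=
  Summit.ABC.ABC.Theorems.SubPowerSY.log_lt_route_a_erase hK hP h hPa

example {K C η : ℝ} (hK : 1 ≤ K) (hη : 0 ≤ η)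
    (hC : ∀ S : Finset ℕ, (∀ p ∈ S, p.Prime) → ∏ p ∈ S, K * Real.log p / (p : ℝ) ^ η ≤ C)
    {u v a b c : ℕ} (hu : u ≠ 0) (hv : v ≠ 0) (huv : u.Coprime v) (hdvd : u * v ∣ a * b * c)
    (h0 : a * b * c ≠ 0) : theta K u v 0 ≤ K * C * (rad a b c : ℝ) ^ η :=
  Summit.ABC.ABC.Theorems.SingleTowerSzpiroLine.theta_zero_le_mul_rpow hK hη hC hu hv huv hdvd h0

example {A η : ℝ} (hA : 0 ≤ A) (hη : 0 < η) :=
  Summit.ABC.ABC.Theorems.SingleTowerSzpiroLine.exists_prod_mul_log_div_rpow_le hA hη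

example {y M : ℝ} (hM : 1 ≤ M) (h : y ≤ M * Real.log (max (Real.exp 1) (2 * y))) :
    y ≤ 2 * M * Real.log (4 * M) :=
  Literature.Barriers.ABC.le_of_le_mul_log_max hM h

example {x y z : ℤ} (hsum : x + y = z) (hx : x ≠ 0) (hy : y ≠ 0) (hz : z ≠ 0) (hcop : IsCoprime x y) :=
  Summit.ABC.ABC.Theorems.PencilBoundLine.exists_abcTriple_of_int_sum hsum hx hy hz hcop

example {u w : ℤ} (h : IsCoprime u w) :=
  Summit.ABC.ABC.Theorems.GoldenFromNFPencil.natAbs_radical_prod h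

end Summit.ABC.ABC.Cruxes.GoldenCuspShadow.SplitCuspExtremes3

end
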